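import Summits.ResolutionOfSingularities.ResolutionOfSingularities.Theorems.WeightedInvariantWeightedConstructionWeightedChartBasicOpen
import Literature.AlgebraicGeometry.Limits.IdealSheafComap
import Mathlib.AlgebraicGeometry.Restrict
import HarnessLib

/-!
# Pull-back of the admissibility condition along a morphism (B2′ ⊇, line `pointwise-lexmax-hull`)

Route `ResolutionOfSingularities/WeightedInvariant`, crux `WeightedConstruction`
(stmt-ResolutionOfSingularities-0571), line `pointwise-lexmax-hull`, stub `stub_plexComap` (B2′), ⊇-half:
an admissible chart `(U, u, w, d)` for `X` at `g y₁` pulls back to an admissible chart for `X.comap g`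
at `y₁`. [OURS · L1 W4.3] This file supplies the IDEAL part: on any affine open `U₁ ⊆ g⁻¹ U`,

* `comap_ideal_le_map_appLE` — `(X.comap g)(U₁) ⊆ X(U) · Γ(Y₁, U₁)` (in fact equal; `⊇` is formal).
  Proof: restrict `g` to the affine scheme `U₁`; there the preimage of `U` is everything, so the affine
  chart formula `Literature.AlgebraicGeometry.Limits.ideal_comap_eq_map` applies, and
  `Γ(Y₁, U₁) ≅ Γ(U₁, ⊤)`.
* `comap_ideal_le_weightedMonomialIdeal` — hence `X(U) ⊆ (u^α : Σ wᵢαᵢ ≥ d)` implies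
  `(X.comap g)(U₁) ⊆ ((g^*u)^α : Σ wᵢαᵢ ≥ d)` (`weightedMonomialIdeal_map`).

No new mathematics; NOT a statement of the manuscript under review.
-/

noncomputable section

set_option linter.dupNamespace false -- mandated namespace of this single-conjunct summit

open CategoryTheory CategoryTheory.Limits AlgebraicGeometry TopologicalSpace
open Literature.AlgebraicGeometry.Resolution

namespace Summit.ResolutionOfSingularities.ResolutionOfSingularities.Theorems

universe u

/-- **Sections of the pull-back ideal sheaf lie in the extended ideal.** For `g : Y₁ → Y`, an ideal
sheaf `X` on `Y`, an affine open `U ⊆ Y` and an affine open `U₁ ⊆ g⁻¹ U`: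
`(X.comap g)(U₁) ≤ X(U) · Γ(Y₁, U₁)` (extension along `g^* : Γ(Y, U) → Γ(Y₁, U₁)`).
[cite: GortzWedhorn2020, Example 4.36 (p. 139)] -/
theorem comap_ideal_le_map_appLE {Y Y₁ : Scheme.{u}} (g : Y₁ ⟶ Y) (X : Y.IdealSheafData)
    (U : Y.affineOpens) (U₁ : Y₁.affineOpens) (h : (U₁ : Y₁.Opens) ≤ g ⁻¹ᵁ (U : Y.Opens)) :
    (X.comap g).ideal U₁ ≤ (X.ideal U).map (g.appLE U U₁ h).hom := by
  intro s hs
  have hpre : (U₁ : Y₁.Opens).ι ⁻¹ᵁ (U₁ : Y₁.Opens) = ⊤ := (U₁ : Y₁.Opens).ι_preimage_self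
  haveI : IsAffine (U₁ : Y₁.Opens).toScheme := U₁.2
  have hWaff : IsAffineOpen ((U₁ : Y₁.Opens).ι ⁻¹ᵁ (U₁ : Y₁.Opens)) := by
    rw [hpre]; exact isAffineOpen_top _
  let W : (U₁ : Y₁.Opens).toScheme.affineOpens := ⟨(U₁ : Y₁.Opens).ι ⁻¹ᵁ (U₁ : Y₁.Opens), hWaff⟩
  -- step 1: pull `s` back along the open immersion `U₁ ↪ Y₁`
  have h1 : (U₁ : Y₁.Opens).ι.app (U₁ : Y₁.Opens) s ∈
      ((X.comap g).comap (U₁ : Y₁.Opens).ι).ideal W :=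
    Literature.AlgebraicGeometry.Limits.map_mem_comap_ideal (U₁ : Y₁.Opens).ι (X.comap g) U₁
      hWaff hs
  rw [← Scheme.IdealSheafData.comap_comp] at h1
  -- step 2: the chart formula for `U₁ ↪ Y₁ → Y`, whose preimage of `U` is all of `U₁`
  have hV : (W : (U₁ : Y₁.Opens).toScheme.Opens) = ((U₁ : Y₁.Opens).ι ≫ g) ⁻¹ᵁ (U : Y.Opens) := by
    apply le_antisymm
    · intro x hx
      have hx1 : (U₁ : Y₁.Opens).ι.base x ∈ (U₁ : Y₁.Opens) := hx
      have hx2 : (U₁ : Y₁.Opens).ι.base x ∈ g ⁻¹ᵁ (U : Y.Opens) := h hx1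
      show ((U₁ : Y₁.Opens).ι ≫ g).base x ∈ (U : Y.Opens)
      rw [Scheme.Hom.comp_base]
      exact hx2
    · intro x _
      show x ∈ (U₁ : Y₁.Opens).ι ⁻¹ᵁ (U₁ : Y₁.Opens)
      rw [hpre]
      trivial
  rw [Literature.AlgebraicGeometry.Limits.ideal_comap_eq_map ((U₁ : Y₁.Opens).ι ≫ g) X U W hV]
    at h1
  -- step 3: factor the pull-back of sections through `Γ(Y₁, U₁)`
  have hfac : ((U₁ : Y₁.Opens).ι ≫ g).appLE U W hV.le =
      g.appLE U U₁ h ≫ (U₁ : Y₁.Opens).ι.app (U₁ : Y₁.Opens) := by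
    rw [← Scheme.Hom.appLE_eq_app]
    exact (Scheme.Hom.appLE_comp_appLE (U₁ : Y₁.Opens).ι g U U₁ W h le_rfl).symm
  rw [hfac, CommRingCat.hom_comp, ← Ideal.map_map] at h1
  -- step 4: `Γ(Y₁, U₁) → Γ(U₁, ι⁻¹ U₁)` is an isomorphism
  haveI : IsIso ((U₁ : Y₁.Opens).ι.app (U₁ : Y₁.Opens)) := by
    rw [Scheme.Opens.ι_app_self]
    exact (Y₁.presheaf.mapIso (eqToIso (X := (U₁ : Y₁.Opens).ι ''ᵁ ((U₁ : Y₁.Opens).ι ⁻¹ᵁ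
      (U₁ : Y₁.Opens))) (Y := (U₁ : Y₁.Opens)) (by simp)).op).isIso_hom
  have hbij := ConcreteCategory.bijective_of_isIso ((U₁ : Y₁.Opens).ι.app (U₁ : Y₁.Opens))
  obtain ⟨x, hx, hxs⟩ := (Ideal.mem_map_iff_of_surjective
    ((U₁ : Y₁.Opens).ι.app (U₁ : Y₁.Opens)).hom hbij.2).mp h1
  have hxs' : x = s := hbij.1 hxs
  exact hxs' ▸ hx

/-- **Admissibility pulls back.** If `X(U) ⊆ (u^α : Σ wᵢ αᵢ ≥ d)` on an affine open `U ⊆ Y`, then on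
every affine open `U₁ ⊆ g⁻¹ U` of `Y₁`, `(X.comap g)(U₁) ⊆ ((g^* u)^α : Σ wᵢ αᵢ ≥ d)` — the ideal
condition of `AdmissibleProfileAt` for the pulled-back chart. [folklore] -/
theorem comap_ideal_le_weightedMonomialIdeal {Y Y₁ : Scheme.{u}} (g : Y₁ ⟶ Y)
    (X : Y.IdealSheafData) (U : Y.affineOpens) (U₁ : Y₁.affineOpens)
    (h : (U₁ : Y₁.Opens) ≤ g ⁻¹ᵁ (U : Y.Opens)) {m : ℕ} (u : Fin m → Γ(Y, U)) (w : Fin m → ℕ)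
    (d : ℕ) (hX : X.ideal U ≤ weightedMonomialIdeal u w d) :
    (X.comap g).ideal U₁ ≤ weightedMonomialIdeal (fun i => (g.appLE U U₁ h).hom (u i)) w d := by
  refine (comap_ideal_le_map_appLE g X U U₁ h).trans ?_
  rw [← weightedMonomialIdeal_map]
  exact Ideal.map_mono hX

end Summit.ResolutionOfSingularities.ResolutionOfSingularities.Theorems

end
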